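import Mathlib
import Summits.MatrixMultiplication.MatrixMultiplication.Theorems.SubgroupIdentityDesigns.Negative.TorusCube
import Summits.MatrixMultiplication.MatrixMultiplication.Theorems.SubgroupIdentityDesigns.Negative.BorelFamilyF

/-!
# Torus ghosts: the level-`k` obstruction behind the torus cube and Theorem H
(negative lemma for the crux `SubgroupIdentityDesigns`, stmt-MatrixMultiplication-14079; cell B2b-5,
gen 6 — report `run/shared/lean/b2b/levelgraded-cu/ORACLE-g6.md` §G6-1)

Level `k` on `M_m(𝔽_p)`, `m = n + 1`: `f = Σ_{rk M ≤ k} c_M ψ(tr(M·))`.  Fix `k+1` coordinates `I₀`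
and the unitriangular block `U_{I₀} = 1 + 𝔫_{I₀}` of `TorusCube`.  For a torus point `τ` (non-zero on
`I₀`) the `U_{I₀}`-coset sum of a mode is `p^{m²}·ψ(Σ_a M_aa τ_a)·[M lower-I₀-block = 0]`
(`TorusCube.sum_psi_trace_cubePt`), and a lower-block-zero `M` of rank `≤ k` has SOME `M_ii = 0`,
`i ∈ I₀` (`card_le_rank_of_triangular_block`) — so its coset-sum phase does not depend on `τ_i`.
Hence every TORUS GHOST — a weight `w(τ)` whose LINE SUMS `Σ_x w(τ with τ_i := x)` vanish for every
`i ∈ I₀` — annihilates all level-`k` functions summed over the cosets `τ U_{I₀}`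
(`torusGhost_sum_eq_zero`), and a ghost with `w(1) ≠ 0` kills every level-`k` identity test on a set
containing those cosets (`no_idTest_of_torusGhost`; crux-clause form `no_design_of_torusGhost` for
subgroups of `GL_m(𝔽_p)`, any `m = n+1`, any `k`).
This one statement contains `no_idTest_of_torusCube` (the cube signs `Π(±1)` are the product ghost)
and the `m = 2, k = 1` ghost criterion `BorelGhost.no_idTest_of_ghost` (zero row and column sums), and
it is the tool for the next cell (`m = 3`, `k = 2`): e.g. the PRISM ghost `w(τ₀,τ₁,τ₂) = μ(τ₀,τ₁)·
([τ₂ = 1] − [τ₂ = a])` with `μ` any coset-cycle ghost of Theorem H shows that a level-`2` identity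
design in `GL₃(𝔽_p)` cannot contain `{1,a}`-translates of a failing Borel configuration of `GL₂`
times the full unitriangular group.  Sorry-free; axioms `propext`, `Classical.choice`, `Quot.sound`.
VALUE = a theorem / certificate format for the finite frontier of the crux, NOT summit progress.
-/

set_option linter.dupNamespace false

noncomputable section

open scoped BigOperators Classical
open Summit.MatrixMultiplication.MatrixMultiplication.Theorems.LieRankDesigns.Negative (GLm Mat)

namespace Summit.MatrixMultiplication.MatrixMultiplication.Theorems.SubgroupIdentityDesigns.Negative

variable {p n : ℕ} [Fact p.Prime]

section TorusGhost

/-- The coset point `τ · (1 + n_e)` of the torus point `τ` (pattern entries read off `e`). -/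
def torusPt (I₀ : Finset (Fin (n + 1))) (τ : Fin (n + 1) → ZMod p) (e : CMat p (n + 1)) :
    CMat p (n + 1) :=
  Matrix.diagonal τ * (1 + cubeNil I₀ e)

/-- `τ (1 + n_e) = 1` iff `τ = 1` and the pattern is zero (for `τ` with non-zero entries). -/
theorem torusPt_eq_one_iff (I₀ : Finset (Fin (n + 1))) (τ : Fin (n + 1) → ZMod p)
    (hτ : ∀ i, τ i ≠ 0) (e : CMat p (n + 1)) :
    torusPt I₀ τ e = 1 ↔ τ = 1 ∧ cubeNil I₀ e = 0 := by
  have hent : ∀ a b : Fin (n + 1), torusPt I₀ τ e a b =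
      τ a * ((if a = b then 1 else 0) + cubeNil I₀ e a b) := by
    intro a b
    rw [torusPt, Matrix.diagonal_mul, Matrix.add_apply, Matrix.one_apply]
  have hnil_diag : ∀ a : Fin (n + 1), cubeNil I₀ e a a = 0 := fun a => by
    simp [cubeNil]
  constructor
  · intro h
    have hab : ∀ a b : Fin (n + 1), τ a * ((if a = b then 1 else 0) + cubeNil I₀ e a b) =
        if a = b then 1 else 0 := by
      intro a b
      rw [← hent, h, Matrix.one_apply]
    constructor
    · funext i
      rw [Pi.one_apply]
      simpa [hnil_diag] using hab i i
    · ext a b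
      rw [Matrix.zero_apply]
      by_cases hab' : a = b
      · subst hab'; exact hnil_diag a
      · have h2 : τ a * cubeNil I₀ e a b = 0 := by simpa [hab'] using hab a b
        exact (mul_eq_zero.1 h2).resolve_left (hτ a)
  · rintro ⟨hτ1, hn⟩
    rw [torusPt, hτ1, hn, add_zero, mul_one]
    exact Matrix.diagonal_one

/-- If `M_ii = 0`, the diagonal phase `Σ_a M_aa τ_a` does not see the coordinate `τ_i`. -/
theorem phase_insertNth (M : CMat p (n + 1)) (i : Fin (n + 1)) (hMi : M i i = 0) (x : ZMod p)
    (τ' : Fin n → ZMod p) :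
    (∑ a : Fin (n + 1), M a a * Fin.insertNth (α := fun _ => ZMod p) i x τ' a) =
      ∑ j : Fin n, M (i.succAbove j) (i.succAbove j) * τ' j := by
  rw [Fin.sum_univ_succAbove _ i, Fin.insertNth_apply_same, hMi, zero_mul, zero_add]
  refine Finset.sum_congr rfl fun j _ => ?_
  rw [Fin.insertNth_apply_succAbove]

/-- **A torus ghost annihilates every phase that misses one of its directions**: if the line sums of
`w` in direction `i` vanish and `M_ii = 0`, then `Σ_τ w(τ) ψ(Σ_a M_aa τ_a) = 0`. -/
theorem torusGhost_phase_eq_zero (w : (Fin (n + 1) → ZMod p) → ℂ) (i : Fin (n + 1))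
    (hline : ∀ τ' : Fin n → ZMod p, ∑ x : ZMod p, w (Fin.insertNth (α := fun _ => ZMod p) i x τ') = 0)
    (M : CMat p (n + 1)) (hMi : M i i = 0) :
    ∑ τ : Fin (n + 1) → ZMod p, w τ * ZMod.stdAddChar (∑ a : Fin (n + 1), M a a * τ a) = 0 := by
  rw [← (Fin.insertNthEquiv (fun _ => ZMod p) i).sum_comp]
  have hq : ∀ q : ZMod p × (Fin n → ZMod p), (Fin.insertNthEquiv (fun _ => ZMod p) i) q =
      Fin.insertNth (α := fun _ => ZMod p) i q.1 q.2 := fun q => rfl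
  simp_rw [hq]
  rw [Fintype.sum_prod_type, Finset.sum_comm]
  refine Finset.sum_eq_zero fun τ' _ => ?_
  simp_rw [phase_insertNth M i hMi]
  rw [← Finset.sum_mul, hline τ', zero_mul]

/-- **Torus ghosts annihilate level-`k` modes.**  `|I₀| = k+1`, `w` supported on torus points
non-zero on `I₀` with vanishing line sums in every direction `i ∈ I₀`, `rk M ≤ k`:
`Σ_τ w(τ) Σ_e ψ(tr(M · τ(1+n_e))) = 0`. -/
theorem torusGhost_mode_eq_zero (k : ℕ) (I₀ : Finset (Fin (n + 1))) (hI : I₀.card = k + 1)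
    (w : (Fin (n + 1) → ZMod p) → ℂ) (hnz : ∀ τ, w τ ≠ 0 → ∀ i ∈ I₀, τ i ≠ 0)
    (hline : ∀ i ∈ I₀, ∀ τ' : Fin n → ZMod p, ∑ x : ZMod p, w (Fin.insertNth (α := fun _ => ZMod p) i x τ') = 0)
    (M : CMat p (n + 1)) (hM : M.rank ≤ k) :
    ∑ τ : Fin (n + 1) → ZMod p, w τ *
      ∑ e : CMat p (n + 1), ZMod.stdAddChar (Matrix.trace (M * torusPt I₀ τ e)) = 0 := by
  have hterm : ∀ τ : Fin (n + 1) → ZMod p,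
      w τ * ∑ e : CMat p (n + 1), ZMod.stdAddChar (Matrix.trace (M * torusPt I₀ τ e)) =
        w τ * (ZMod.stdAddChar (∑ a : Fin (n + 1), M a a * τ a) *
          (if ∀ a b : Fin (n + 1), (b ∈ I₀ ∧ a ∈ I₀ ∧ b < a) → M a b = 0
            then ((p : ℂ) ^ ((n + 1) * (n + 1))) else 0)) := by
    intro τ
    by_cases hw : w τ = 0
    · rw [hw, zero_mul, zero_mul]
    · simp only [torusPt]
      rw [sum_psi_trace_cubePt I₀ τ (hnz τ hw) M]
  simp_rw [hterm]
  by_cases hup : ∀ a b : Fin (n + 1), (b ∈ I₀ ∧ a ∈ I₀ ∧ b < a) → M a b = 0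
  · simp_rw [if_pos hup]
    by_cases hdiag : ∀ i ∈ I₀, M i i ≠ 0
    · exfalso
      have := card_le_rank_of_triangular_block I₀ M hup hdiag
      omega
    · push Not at hdiag
      obtain ⟨i, hi, hMi⟩ := hdiag
      calc (∑ τ : Fin (n + 1) → ZMod p, w τ * (ZMod.stdAddChar (∑ a : Fin (n + 1), M a a * τ a) *
            (p : ℂ) ^ ((n + 1) * (n + 1))))
          = (p : ℂ) ^ ((n + 1) * (n + 1)) *
              ∑ τ : Fin (n + 1) → ZMod p, w τ * ZMod.stdAddChar (∑ a : Fin (n + 1), M a a * τ a) := by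
            rw [Finset.mul_sum]
            exact Finset.sum_congr rfl fun τ _ => by ring
        _ = 0 := by rw [torusGhost_phase_eq_zero w i (hline i hi) M hMi, mul_zero]
  · simp_rw [if_neg hup, mul_zero, Finset.sum_const_zero]

/-- **TORUS-GHOST SUMS VANISH ON LEVEL `k`** (generalises `torusCube_sum_eq_zero`: the cube signs are
the product ghost). -/
theorem torusGhost_sum_eq_zero (k : ℕ) (I₀ : Finset (Fin (n + 1))) (hI : I₀.card = k + 1)
    (w : (Fin (n + 1) → ZMod p) → ℂ) (hnz : ∀ τ, w τ ≠ 0 → ∀ i ∈ I₀, τ i ≠ 0)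
    (hline : ∀ i ∈ I₀, ∀ τ' : Fin n → ZMod p, ∑ x : ZMod p, w (Fin.insertNth (α := fun _ => ZMod p) i x τ') = 0)
    (c : CMat p (n + 1) → ℂ) (hc : ∀ M : CMat p (n + 1), k < M.rank → c M = 0) :
    ∑ τ : Fin (n + 1) → ZMod p, w τ * ∑ e : CMat p (n + 1), fourierMat c (torusPt I₀ τ e) = 0 := by
  have hre : (∑ τ : Fin (n + 1) → ZMod p, w τ * ∑ e : CMat p (n + 1), fourierMat c (torusPt I₀ τ e))
      = ∑ M : CMat p (n + 1), c M * ∑ τ : Fin (n + 1) → ZMod p, w τ *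
          ∑ e : CMat p (n + 1), ZMod.stdAddChar (Matrix.trace (M * torusPt I₀ τ e)) := by
    simp only [fourierMat, Finset.mul_sum]
    calc (∑ τ : Fin (n + 1) → ZMod p, ∑ e : CMat p (n + 1), ∑ M : CMat p (n + 1),
          w τ * (c M * ZMod.stdAddChar (Matrix.trace (M * torusPt I₀ τ e))))
        = ∑ τ : Fin (n + 1) → ZMod p, ∑ M : CMat p (n + 1), ∑ e : CMat p (n + 1),
            w τ * (c M * ZMod.stdAddChar (Matrix.trace (M * torusPt I₀ τ e))) :=
          Finset.sum_congr rfl fun τ _ => Finset.sum_comm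
      _ = ∑ M : CMat p (n + 1), ∑ τ : Fin (n + 1) → ZMod p, ∑ e : CMat p (n + 1),
            w τ * (c M * ZMod.stdAddChar (Matrix.trace (M * torusPt I₀ τ e))) := Finset.sum_comm
      _ = _ := Finset.sum_congr rfl fun M _ => Finset.sum_congr rfl fun τ _ =>
          Finset.sum_congr rfl fun e _ => by ring
  rw [hre]
  refine Finset.sum_eq_zero fun M _ => ?_
  by_cases hM : M.rank ≤ k
  · rw [torusGhost_mode_eq_zero k I₀ hI w hnz hline M hM, mul_zero]
  · rw [hc M (by omega), zero_mul]

/-- **NO LEVEL-`k` IDENTITY TEST IN THE PRESENCE OF A TORUS GHOST.**  Let `S ⊆ M_m(𝔽_p)` contain every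
coset point `τ(1 + n_e)` of the torus points `τ` carrying the ghost `w` (`|I₀| = k+1`; `τ` with
non-zero entries; line sums of `w` zero in every direction `i ∈ I₀`; `w(1) ≠ 0`).  Then no
rank-`≤ k`-supported `c` has `f_c(1) = 1` and `f_c = 0` on `S ∖ {1}`. -/
theorem no_idTest_of_torusGhost (k : ℕ) (I₀ : Finset (Fin (n + 1))) (hI : I₀.card = k + 1)
    (w : (Fin (n + 1) → ZMod p) → ℂ) (hnz : ∀ τ, w τ ≠ 0 → ∀ i, τ i ≠ 0)
    (hline : ∀ i ∈ I₀, ∀ τ' : Fin n → ZMod p, ∑ x : ZMod p, w (Fin.insertNth (α := fun _ => ZMod p) i x τ') = 0)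
    (h1w : w 1 ≠ 0) (S : Set (CMat p (n + 1)))
    (hS : ∀ τ e, w τ ≠ 0 → torusPt I₀ τ e ∈ S)
    (c : CMat p (n + 1) → ℂ) (hc : ∀ M : CMat p (n + 1), k < M.rank → c M = 0)
    (h1 : fourierMat c 1 = 1) (h0 : ∀ s ∈ S, s ≠ 1 → fourierMat c s = 0) : False := by
  have hsum := torusGhost_sum_eq_zero k I₀ hI w (fun τ hτ i _ => hnz τ hτ i) hline c hc
  have hval : ∀ (τ : Fin (n + 1) → ZMod p) (e : CMat p (n + 1)),
      w τ * fourierMat c (torusPt I₀ τ e) = if τ = 1 ∧ cubeNil I₀ e = 0 then w 1 else 0 := by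
    intro τ e
    by_cases hw : w τ = 0
    · rw [hw, zero_mul]
      split_ifs with h
      · obtain ⟨rfl, -⟩ := h
        exact hw.symm
      · rfl
    · by_cases h : torusPt I₀ τ e = 1
      · obtain ⟨hτ, hn⟩ := (torusPt_eq_one_iff I₀ τ (hnz τ hw) e).1 h
        subst hτ
        rw [h, h1, mul_one, if_pos ⟨rfl, hn⟩]
      · rw [h0 _ (hS τ e hw) h, mul_zero, if_neg]
        rintro ⟨rfl, hn⟩
        exact h ((torusPt_eq_one_iff I₀ 1 (hnz 1 hw) e).2 ⟨rfl, hn⟩)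
  simp_rw [Finset.mul_sum, hval] at hsum
  rw [Finset.sum_comm] at hsum
  have hcount : (∑ e : CMat p (n + 1), ∑ τ : Fin (n + 1) → ZMod p,
      (if τ = 1 ∧ cubeNil I₀ e = 0 then w 1 else (0 : ℂ))) =
      ((Finset.univ.filter fun e : CMat p (n + 1) => cubeNil I₀ e = 0).card : ℂ) * w 1 := by
    have : ∀ e : CMat p (n + 1), (∑ τ : Fin (n + 1) → ZMod p,
        (if τ = 1 ∧ cubeNil I₀ e = 0 then w 1 else (0 : ℂ))) =
        if cubeNil I₀ e = 0 then w 1 else 0 := by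
      intro e
      by_cases he : cubeNil I₀ e = 0
      · simp [he, Finset.sum_ite_eq']
      · simp [he]
    simp_rw [this]
    rw [Finset.sum_ite, Finset.sum_const_zero, add_zero, Finset.sum_const, nsmul_eq_mul]
  rw [hcount] at hsum
  have hpos : 0 < (Finset.univ.filter fun e : CMat p (n + 1) => cubeNil I₀ e = 0).card :=
    Finset.card_pos.2 ⟨0, by simp [cubeNil]; rfl⟩
  have hne : ((Finset.univ.filter fun e : CMat p (n + 1) => cubeNil I₀ e = 0).card : ℂ) ≠ 0 :=
    Nat.cast_ne_zero.2 hpos.ne'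
  exact mul_ne_zero hne h1w hsum

/-- **The crux-language form** (any `m = n+1`, any `k`): if the triple products of `H₁, H₂, H₃ ≤ GL_m(𝔽_p)`
contain the cosets `τ U_{I₀}` of a torus ghost `w` (`|I₀| = k+1`, zero line sums, `w(1) ≠ 0`), the
identity-design clause of `SubgroupIdentityDesigns` fails at level `k` for `(H₁, H₂, H₃)`. -/
theorem no_design_of_torusGhost {H₁ H₂ H₃ : Subgroup (GLm p (n + 1))} (k : ℕ)
    (I₀ : Finset (Fin (n + 1))) (hI : I₀.card = k + 1)
    (w : (Fin (n + 1) → ZMod p) → ℂ) (hnz : ∀ τ, w τ ≠ 0 → ∀ i, τ i ≠ 0)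
    (hline : ∀ i ∈ I₀, ∀ τ' : Fin n → ZMod p, ∑ x : ZMod p, w (Fin.insertNth (α := fun _ => ZMod p) i x τ') = 0)
    (h1w : w 1 ≠ 0)
    (hS : ∀ τ e, w τ ≠ 0 → ∃ a ∈ H₁, ∃ b ∈ H₂, ∃ g ∈ H₃,
      ((a * b * g : GLm p (n + 1)) : Mat p (n + 1)) = torusPt I₀ τ e) :
    ¬ ∃ c : Matrix (Fin (n + 1)) (Fin (n + 1)) (ZMod p) → ℂ, (∀ M, k < M.rank → c M = 0) ∧
      (∑ M, c M * ZMod.stdAddChar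
        (Matrix.trace (M * ((1 : GLm p (n + 1)) : Mat p (n + 1))))) = 1 ∧
      ∀ a ∈ H₁, ∀ b ∈ H₂, ∀ g ∈ H₃, a * b * g ≠ 1 →
        (∑ M, c M * ZMod.stdAddChar
          (Matrix.trace (M * ((a * b * g : GLm p (n + 1)) : Mat p (n + 1))))) = 0 := by
  rintro ⟨c, hc, h1, h0⟩
  set S : Set (CMat p (n + 1)) :=
    {s | ∃ a ∈ H₁, ∃ b ∈ H₂, ∃ g ∈ H₃, s = ((a * b * g : GLm p (n + 1)) : Mat p (n + 1))}
    with hS_def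
  have hS' : ∀ τ e, w τ ≠ 0 → torusPt I₀ τ e ∈ S := by
    intro τ e hw
    obtain ⟨a, ha, b, hb, g, hg, hs⟩ := hS τ e hw
    exact ⟨a, ha, b, hb, g, hg, hs.symm⟩
  have h1' : fourierMat c 1 = 1 := by simpa [fourierMat] using h1
  have h0' : ∀ s ∈ S, s ≠ 1 → fourierMat c s = 0 := by
    rintro s ⟨a, ha, b, hb, g, hg, rfl⟩ hs1
    have hne : a * b * g ≠ 1 := fun h => hs1 (by rw [h, Units.val_one])
    simpa [fourierMat] using h0 a ha b hb g hg hne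
  exact no_idTest_of_torusGhost k I₀ hI w hnz hline h1w S hS' c hc h1' h0'

end TorusGhost

end Summit.MatrixMultiplication.MatrixMultiplication.Theorems.SubgroupIdentityDesigns.Negative

end
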